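import Summits.BirchSwinnertonDyer.BirchSwinnertonDyer.Theorems.GenusKolyvaginAtTwoTorsionCellLevelZeroRigidity
import HarnessLib

/-!
# LINE 49 «full_vertex» — LEVEL-0 RIGIDITY, steps (1)–(2): rational Kummer classes and biquadratic Kummer theory (MQ)

Crux R″ `RankOneTwoTorsionResidualAtTwo` (stmt-BirchSwinnertonDyer-27478) of route GenusKolyvaginAtTwo, LINE 49
«torsion_cell_full_vertex_bsdidea1» (pen bsd-idea-1); sequel of `…LevelZeroRigidity` (LEMMA L0 of memo #6 r4 §4bis.7,
steps (3)–(5) kernel; remaining hypothesis «the Kummer class of the half `R ∈ E₀(K₀)` is rational», i.e. the memo's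
steps (1)–(2)).  This file supplies the two algebraic ingredients of (1)–(2), DEF-FREE:

* §1 **(MQ) for a biquadratic tower** `K₀ ⊆ L₁ = K₀(r₁) ⊆ M = L₁(r₂)`, `r₁² = d₁`, `r₂² = d₂` (`dᵢ ∈ K₀`; the genus field
  `K_gen = K₀(√−q₁, √−q₂)` over `K₀ = ℚ(√−p₀)`): an element of `K₀` that becomes a square in `M` lies in
  `{1, d₁, d₂, d₁d₂} · K₀²` (`exists_mul_sq_of_isSquare_biquadratic`, two applications of the tree's one-step lemmas
  `…TorsionControl.exists_sq_or_mul_sq_of_quadratic` / `mem_or_div_mem_of_isSquare_step`); hence (memo step (2))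
  **`exists_ratCast_mul_sq_of_biquadratic`**: if `b ∈ K₀` is `a · w²` in `M` with `a ∈ ℚ^×` and `d₁, d₂ ∈ ℚ`, then
  `b = a′ · u²` with `a′ ∈ ℚ`, `u ∈ K₀` — exactly the hypothesis `hrat` of `…LevelZero.twoDescentComponent_smul_of_rational`
  for `b = x(R) − eᵢ`.
* §2 **RATIONAL KUMMER CLASSES over one field** `M ⊇ F` (memo step (1)): the `Tᵢ`-component of the Kummer class of a point
  with `F`-RATIONAL `x`-coordinate is the class of a non-zero element of `F` (`exists_twoDescentComponent_eq_of_x_rational`;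
  covers `z′`, the `g′_d`, and `E₀[2]`); such classes are closed under `+` (`twoDescentComponent_add_eq_sqClass_algebraMap`)
  and `−`, so every element of the subgroup they generate (`M′ + E₀[2]`) has a rational class
  (`exists_twoDescentComponent_eq_of_mem_closure`); and **`twoDescentComponent_eq_of_add_eq_add_self`**: if
  `R + N = W′ + W′` then `κᵢ(R) = κᵢ(N)` — so `2W̃ = R + m + s` with `m + s ∈ M′ + E₀[2]` makes `κ(R)` rational.

With `…LevelZeroRigidity` this makes LEMMA L0 kernel modulo (T4) and the identification of the objects (which field is `K_gen`,
which point is `R_{−p₀}`).  Pure `2`-descent algebra; no Heegner point.  Everything is proved (no `sorry`, standard axioms);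
nothing here is a statement of the line, and NOTHING HERE PROVES R″ or any summit — BSD is not advanced by this file alone.

## References

* [SilvermanAEC2009] J. H. Silverman, *The Arithmetic of Elliptic Curves*, 2nd ed. (2009), Prop. X.1.4, VIII.§1 (Kummer theory
  of `K(√·)/K`).
* [Kramer1981] K. Kramer, *Arithmetic of elliptic curves upon quadratic extension*, Trans. AMS 264 (1981), §1.
-/

open WeierstrassCurve WeierstrassCurve.Affine
open WeierstrassCurve.Affine.Point hiding some
open scoped Classical

noncomputable section

namespace Summit.BirchSwinnertonDyer.BirchSwinnertonDyer.Theorems.GenusKolyvaginAtTwo.FullVertex.LevelZero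

/-! ## §1 (MQ): squares in a biquadratic tower -/

section MQ

variable {K₀ L₁ M : Type*} [Field K₀] [CharZero K₀] [Field L₁] [CharZero L₁] [Field M]
  [Algebra K₀ L₁] [Algebra L₁ M] [Algebra K₀ M] [IsScalarTower K₀ L₁ M]

/-- **(MQ), biquadratic.**  `K₀ ⊆ L₁ = K₀(r₁) ⊆ M = L₁(r₂)` with `r₁² = d₁`, `r₂² = d₂` (`d₁, d₂ ∈ K₀`): an element `c ∈ K₀`
which becomes a square in `M` satisfies `c = δ · u²` with `δ ∈ {1, d₁, d₂, d₁d₂}`, `u ∈ K₀`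
(`ker(K₀^×/□ → M^×/□) ⊆ ⟨d₁, d₂⟩`). [cite: SilvermanAEC2009, VIII.§1] [cite: Kramer1981, §1] -/
theorem exists_mul_sq_of_isSquare_biquadratic {d₁ d₂ : K₀} {r₁ : L₁} {r₂ : M}
    (hr₁ : r₁ ^ 2 = algebraMap K₀ L₁ d₁)
    (hgen₁ : ∀ w : L₁, ∃ a b : K₀, w = algebraMap K₀ L₁ a + algebraMap K₀ L₁ b * r₁)
    (hr₂ : r₂ ^ 2 = algebraMap K₀ M d₂)
    (hgen₂ : ∀ w : M, ∃ a b : L₁, w = algebraMap L₁ M a + algebraMap L₁ M b * r₂)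
    {c : K₀} (hc : ∃ w : M, algebraMap K₀ M c = w ^ 2) :
    ∃ u : K₀, c = u ^ 2 ∨ c = d₁ * u ^ 2 ∨ c = d₂ * u ^ 2 ∨ c = (d₁ * d₂) * u ^ 2 := by
  have hG : ∀ c : K₀, (∃ s : L₁, algebraMap K₀ L₁ c = s ^ 2) →
      c ∈ {c : K₀ | ∃ u : K₀, c = u ^ 2 ∨ c = d₁ * u ^ 2} :=
    fun c hc => TorsionControl.exists_sq_or_mul_sq_of_quadratic hr₁ hgen₁ hc
  rcases TorsionControl.mem_or_div_mem_of_isSquare_step hr₂ hgen₂ hG hc with h | ⟨hd, h⟩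
  · obtain ⟨u, hu | hu⟩ := h
    · exact ⟨u, Or.inl hu⟩
    · exact ⟨u, Or.inr (Or.inl hu)⟩
  · obtain ⟨u, hu | hu⟩ := h
    · refine ⟨u, Or.inr (Or.inr (Or.inl ?_))⟩
      rw [div_eq_iff hd] at hu
      linear_combination hu
    · refine ⟨u, Or.inr (Or.inr (Or.inr ?_))⟩
      rw [div_eq_iff hd] at hu
      linear_combination hu

/-- **(MQ) with rational data — memo step (2).**  In the biquadratic tower with `d₁ = q₁`, `d₂ = q₂` RATIONAL (the genus
field `K_gen = K₀(√−q₁, √−q₂)`): if `b ∈ K₀` equals `a · w²` in `M` with `a ∈ ℚ^×`, then `b = a′ · u²` with `a′ ∈ ℚ` and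
`u ∈ K₀` — the hypothesis `hrat` of `twoDescentComponent_smul_of_rational` for `b = x(R) − eᵢ`: a `K₀`-Kummer class that
becomes rational in `K_gen` is rational. [cite: SilvermanAEC2009, VIII.§1] [cite: Kramer1981, §1] -/
theorem exists_ratCast_mul_sq_of_biquadratic [Algebra ℚ K₀] {q₁ q₂ : ℚ} {r₁ : L₁} {r₂ : M}
    (hr₁ : r₁ ^ 2 = algebraMap K₀ L₁ (algebraMap ℚ K₀ q₁))
    (hgen₁ : ∀ w : L₁, ∃ a b : K₀, w = algebraMap K₀ L₁ a + algebraMap K₀ L₁ b * r₁)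
    (hr₂ : r₂ ^ 2 = algebraMap K₀ M (algebraMap ℚ K₀ q₂))
    (hgen₂ : ∀ w : M, ∃ a b : L₁, w = algebraMap L₁ M a + algebraMap L₁ M b * r₂)
    {b : K₀} {a : ℚ} (ha : a ≠ 0)
    (hb : ∃ w : M, algebraMap K₀ M b = algebraMap K₀ M (algebraMap ℚ K₀ a) * w ^ 2) :
    ∃ (a' : ℚ) (u : K₀), b = algebraMap ℚ K₀ a' * u ^ 2 := by
  have ha0 : algebraMap ℚ K₀ a ≠ 0 := (map_ne_zero _).mpr ha
  have hc : ∃ w : M, algebraMap K₀ M (b / algebraMap ℚ K₀ a) = w ^ 2 := by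
    obtain ⟨w, hw⟩ := hb
    refine ⟨w, ?_⟩
    rw [map_div₀, hw, mul_div_cancel_left₀ _ ((map_ne_zero _).mpr ha0)]
  obtain ⟨u, hu⟩ := exists_mul_sq_of_isSquare_biquadratic hr₁ hgen₁ hr₂ hgen₂ hc
  have hb' : b = algebraMap ℚ K₀ a * (b / algebraMap ℚ K₀ a) := by rw [mul_div_cancel₀ _ ha0]
  rcases hu with hu | hu | hu | hu
  · exact ⟨a, u, by rw [hb', hu]⟩
  · exact ⟨a * q₁, u, by rw [hb', hu, map_mul]; ring⟩
  · exact ⟨a * q₂, u, by rw [hb', hu, map_mul]; ring⟩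
  · exact ⟨a * (q₁ * q₂), u, by rw [hb', hu, map_mul, map_mul]; ring⟩

end MQ

/-! ## §2 Rational Kummer classes over one field (memo step (1)) -/

section RationalClass

universe u

variable {F M : Type u} [Field F] [Field M] [Algebra F M] [CharZero F] [CharZero M]
  {W : WeierstrassCurve F} [W.IsElliptic] {e₁ e₂ e₃ : F}

omit [CharZero F] [CharZero M] in
/-- **Points with rational `x`-coordinate have rational Kummer class**: for `P = (x, y) ∈ E(M)` with `x = ι(x₀)`, `x₀ ∈ F`
(e.g. `z′`, the `g′_d`, the `Tᵢ`), the `T₁`-component of `κ(P)` is the class of a non-zero element of `F`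
(`x₀ − e₁`, or `(e₁−e₂)(e₁−e₃)` at `T₁`). [cite: SilvermanAEC2009, Prop. X.1.4] -/
theorem exists_twoDescentComponent_eq_of_x_rational (h : W.toAffine.SplitTwoTorsion e₁ e₂ e₃) {x y : M}
    (hxy : (W.baseChange M).toAffine.Nonsingular x y) {x₀ : F} (hx : x = algebraMap F M x₀) :
    ∃ a : F, a ≠ 0 ∧
      twoDescentComponent (W.baseChange M).toAffine (algebraMap F M e₁) (algebraMap F M e₂) (algebraMap F M e₃)
        (Point.some x y hxy) = sqClass (algebraMap F M a) := by
  by_cases h1 : x₀ = e₁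
  · refine ⟨(e₁ - e₂) * (e₁ - e₃), h.c_ne_zero, ?_⟩
    rw [twoDescentComponent_some_of_eq _ (by rw [hx, h1]), ← map_sub, ← map_sub, ← map_mul]
  · refine ⟨x₀ - e₁, sub_ne_zero.mpr h1, ?_⟩
    have hne : x ≠ algebraMap F M e₁ := fun e => h1 ((algebraMap F M).injective (hx ▸ e))
    rw [twoDescentComponent_some_of_ne _ hne, hx, ← map_sub]

omit [CharZero F] [CharZero M] [W.IsElliptic] in
/-- The point `O` has rational Kummer class (the class of `1`). [cite: SilvermanAEC2009, Prop. X.1.4] -/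
theorem twoDescentComponent_zero_eq_sqClass_one :
    twoDescentComponent (W.baseChange M).toAffine (algebraMap F M e₁) (algebraMap F M e₂) (algebraMap F M e₃) 0 =
      sqClass (algebraMap F M 1) := by
  rw [twoDescentComponent_zero, map_one, ← sqClass_mul_self (1 : M), one_mul]

omit [CharZero F] in
/-- **Rational Kummer classes are closed under addition**: `κ₁(P) = [a]`, `κ₁(Q) = [b]` (`a, b ∈ F^×`) ⟹ `κ₁(P + Q) = [ab]`.
[cite: SilvermanAEC2009, Prop. X.1.4] -/
theorem twoDescentComponent_add_eq_sqClass_algebraMap (h : W.toAffine.SplitTwoTorsion e₁ e₂ e₃)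
    {P Q : (W.baseChange M).toAffine.Point} {a b : F} (ha : a ≠ 0) (hb : b ≠ 0)
    (hP : twoDescentComponent (W.baseChange M).toAffine (algebraMap F M e₁) (algebraMap F M e₂) (algebraMap F M e₃)
      P = sqClass (algebraMap F M a))
    (hQ : twoDescentComponent (W.baseChange M).toAffine (algebraMap F M e₁) (algebraMap F M e₂) (algebraMap F M e₃)
      Q = sqClass (algebraMap F M b)) :
    twoDescentComponent (W.baseChange M).toAffine (algebraMap F M e₁) (algebraMap F M e₂) (algebraMap F M e₃)
      (P + Q) = sqClass (algebraMap F M (a * b)) := by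
  haveI : (W.baseChange M).IsElliptic := inferInstanceAs ((W.map (algebraMap F M)).IsElliptic)
  rw [twoDescentComponent_add (TorsionControl.splitTwoTorsion_baseChange (L := M) h), hP, hQ, map_mul,
    sqClass_mul ((map_ne_zero _).mpr ha) ((map_ne_zero _).mpr hb)]

omit [CharZero F] [CharZero M] [W.IsElliptic] in
/-- Rational Kummer classes are closed under negation (`κ(−P) = κ(P)`). [cite: SilvermanAEC2009, Prop. X.1.4] -/
theorem twoDescentComponent_neg_eq_sqClass_algebraMap {P : (W.baseChange M).toAffine.Point} {a : F}
    (hP : twoDescentComponent (W.baseChange M).toAffine (algebraMap F M e₁) (algebraMap F M e₂) (algebraMap F M e₃)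
      P = sqClass (algebraMap F M a)) :
    twoDescentComponent (W.baseChange M).toAffine (algebraMap F M e₁) (algebraMap F M e₂) (algebraMap F M e₃)
      (-P) = sqClass (algebraMap F M a) := by
  rw [twoDescentComponent_neg, hP]

omit [CharZero F] in
/-- **The subgroup generated by points with rational Kummer class has rational Kummer classes** (`M′ + E₀[2]`, generated by
`z′`, the `g′_d` and the `Tᵢ`, all with rational `x`-coordinate). [cite: SilvermanAEC2009, Prop. X.1.4] -/
theorem exists_twoDescentComponent_eq_of_mem_closure (h : W.toAffine.SplitTwoTorsion e₁ e₂ e₃)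
    (gens : Set (W.baseChange M).toAffine.Point)
    (hgens : ∀ P ∈ gens, ∃ a : F, a ≠ 0 ∧
      twoDescentComponent (W.baseChange M).toAffine (algebraMap F M e₁) (algebraMap F M e₂) (algebraMap F M e₃) P =
        sqClass (algebraMap F M a))
    {m : (W.baseChange M).toAffine.Point} (hm : m ∈ AddSubgroup.closure gens) :
    ∃ a : F, a ≠ 0 ∧
      twoDescentComponent (W.baseChange M).toAffine (algebraMap F M e₁) (algebraMap F M e₂) (algebraMap F M e₃) m =
        sqClass (algebraMap F M a) := by
  refine AddSubgroup.closure_induction (p := fun m _ => ∃ a : F, a ≠ 0 ∧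
      twoDescentComponent (W.baseChange M).toAffine (algebraMap F M e₁) (algebraMap F M e₂) (algebraMap F M e₃) m =
        sqClass (algebraMap F M a)) ?_ ?_ ?_ ?_ hm
  · exact fun P hP => hgens P hP
  · exact ⟨1, one_ne_zero, twoDescentComponent_zero_eq_sqClass_one⟩
  · rintro P Q _ _ ⟨a, ha, hP⟩ ⟨b, hb, hQ⟩
    exact ⟨a * b, mul_ne_zero ha hb, twoDescentComponent_add_eq_sqClass_algebraMap h ha hb hP hQ⟩
  · rintro P _ ⟨a, ha, hP⟩
    exact ⟨a, ha, twoDescentComponent_neg_eq_sqClass_algebraMap hP⟩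

omit [CharZero F] in
/-- **Memo step (1): `R + N ∈ 2E(M) ⟹ κ(R) = κ(N)`** (the Kummer map kills `2E(M)` and its values are involutions).  With
`N = m + s ∈ M′ + E₀[2]` this makes the Kummer class of the half `R = 2W̃ − m − s` RATIONAL. [cite: SilvermanAEC2009, Prop. X.1.4] -/
theorem twoDescentComponent_eq_of_add_eq_add_self (h : W.toAffine.SplitTwoTorsion e₁ e₂ e₃)
    {R N W' : (W.baseChange M).toAffine.Point} (hRN : R + N = W' + W') :
    twoDescentComponent (W.baseChange M).toAffine (algebraMap F M e₁) (algebraMap F M e₂) (algebraMap F M e₃) R =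
      twoDescentComponent (W.baseChange M).toAffine (algebraMap F M e₁) (algebraMap F M e₂) (algebraMap F M e₃) N := by
  haveI : (W.baseChange M).IsElliptic := inferInstanceAs ((W.map (algebraMap F M)).IsElliptic)
  have hM := TorsionControl.splitTwoTorsion_baseChange (L := M) h
  have key := congrArg
    (twoDescentComponent (W.baseChange M).toAffine (algebraMap F M e₁) (algebraMap F M e₂) (algebraMap F M e₃)) hRN
  simp only [twoDescentComponent_add hM, SqUnits.mul_self] at key
  rw [SqUnits.eq_mul_of_mul_eq key, SqUnits.one_mul]

omit [CharZero F] in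
/-- **Memo step (1), assembled**: if `R + N = W′ + W′` with `N` in the subgroup generated by points with rational Kummer class
(rational `x`-coordinates: `M′ + E₀[2]`), then the `T₁`-component of `κ(R)` is the class of a non-zero element of `F`; for an
affine `R = (x, y)` with `x ≠ e₁` this gives `x − e₁ = a · w²` with `a ∈ F^×`, `w ∈ M` (`exists_eq_mul_sq_of_sqClass_eq`).
[cite: SilvermanAEC2009, Prop. X.1.4] -/
theorem exists_twoDescentComponent_eq_of_add_eq_add_self (h : W.toAffine.SplitTwoTorsion e₁ e₂ e₃)
    (gens : Set (W.baseChange M).toAffine.Point)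
    (hgens : ∀ P ∈ gens, ∃ a : F, a ≠ 0 ∧
      twoDescentComponent (W.baseChange M).toAffine (algebraMap F M e₁) (algebraMap F M e₂) (algebraMap F M e₃) P =
        sqClass (algebraMap F M a))
    {R N W' : (W.baseChange M).toAffine.Point} (hN : N ∈ AddSubgroup.closure gens) (hRN : R + N = W' + W') :
    ∃ a : F, a ≠ 0 ∧
      twoDescentComponent (W.baseChange M).toAffine (algebraMap F M e₁) (algebraMap F M e₂) (algebraMap F M e₃) R =
        sqClass (algebraMap F M a) := by
  obtain ⟨a, ha, hNa⟩ := exists_twoDescentComponent_eq_of_mem_closure h gens hgens hN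
  exact ⟨a, ha, (twoDescentComponent_eq_of_add_eq_add_self h hRN).trans hNa⟩

omit [CharZero F] [CharZero M] [W.IsElliptic] in
/-- From the class form to the coordinate form: for `R = (x, y)` with `x ≠ e₁` and `κ₁(R) = [a]`, `a ∈ F^×`:
`x − e₁ = a · w²` for some `w ∈ M`. [cite: SilvermanAEC2009, Prop. X.1.4] -/
theorem exists_sub_eq_algebraMap_mul_sq {x y : M} (hxy : (W.baseChange M).toAffine.Nonsingular x y)
    (hx : x ≠ algebraMap F M e₁) {a : F} (ha : a ≠ 0)
    (hR : twoDescentComponent (W.baseChange M).toAffine (algebraMap F M e₁) (algebraMap F M e₂) (algebraMap F M e₃)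
      (Point.some x y hxy) = sqClass (algebraMap F M a)) :
    ∃ w : M, x - algebraMap F M e₁ = algebraMap F M a * w ^ 2 := by
  rw [twoDescentComponent_some_of_ne _ hx] at hR
  exact exists_eq_mul_sq_of_sqClass_eq ((map_ne_zero _).mpr ha) (sub_ne_zero.mpr hx) hR

end RationalClass

/-! ## §3 LEMMA L0 assembled over the biquadratic genus layer (steps (1)–(5) chained; appended by LEAD gk2-p1 g38) -/

section Assembled

variable {K₀ : Type} {L₁ M : Type*} [Field K₀] [CharZero K₀] [Algebra ℚ K₀] [Field L₁] [CharZero L₁] [Field M]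
  [Algebra K₀ L₁] [Algebra L₁ M] [Algebra K₀ M] [IsScalarTower K₀ L₁ M]
  {W : WeierstrassCurve ℚ} [W.IsElliptic]

/-- **LEMMA L0, assembled (memo #6 r4 §4bis.7, steps (2)–(5) kernel; step (1) = the hypotheses `hup₁`, `hup₂`).**
`E₀/ℚ` an integral full-`2`-torsion base (`eᵢ ∈ ℤ`, `p₀ ∤ eᵢ − eⱼ`, `p₀ ∤ M₀ ≠ 0`), `K₀ = ℚ(r)`, `r² = −p₀M₀`, no rational
point of order `4` (`hT4`, cf. `…LevelZero.two_nsmul_eq_zero_of_four_nsmul_eq_zero`); a biquadratic layer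
`K₀ ⊆ L₁ = K₀(r₁) ⊆ M = L₁(r₂)` with `r₁² = q₁`, `r₂² = q₂` RATIONAL (the genus field `K_gen`); `σ ∈ Aut(K₀/ℚ)`; an affine
point `R = (x, y) ∈ E₀(K₀)` with `R + R = g + t`, `σ • g = −g`, `σ • t = t`, `t + t = O`, whose Kummer values `x − e₁`, `x − e₂`
become RATIONAL TIMES A SQUARE in `M` (`hup`: the output of step (1), e.g. from `2W̃ = R + m + s` upstairs via
`exists_twoDescentComponent_eq_of_add_eq_add_self` + `exists_sub_eq_algebraMap_mul_sq`).  Then `σ • R = −R`: the half `R` of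
`g′_{−p₀} + t` is anti-invariant, so `g′_{−p₀}` is not primitive in `E₀(K₀)⁻/tors` — LEVEL-`0` GLUE IS IMPOSSIBLE.
[cite: SilvermanAEC2009, Prop. X.1.4] [cite: Kramer1981, §1] -/
theorem smul_eq_neg_of_half_of_biquadratic [DecidableEq ℚ] {e₁ e₂ e₃ : ℤ}
    (h : W.toAffine.SplitTwoTorsion (e₁ : ℚ) (e₂ : ℚ) (e₃ : ℚ))
    (p₀ M₀ : ℕ) [Fact p₀.Prime] (h₁₂ : ¬ (p₀ : ℤ) ∣ e₁ - e₂) (h₁₃ : ¬ (p₀ : ℤ) ∣ e₁ - e₃)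
    (h₂₃ : ¬ (p₀ : ℤ) ∣ e₂ - e₃) (hM : ¬ p₀ ∣ M₀) (hM0 : M₀ ≠ 0) {r : K₀}
    (hr : r ^ 2 = algebraMap ℚ K₀ (-((p₀ * M₀ : ℕ) : ℚ)))
    (hgen : ∀ w : K₀, ∃ a b : ℚ, w = algebraMap ℚ K₀ a + algebraMap ℚ K₀ b * r)
    (hT4 : ∀ Q : W.toAffine.Point, (4 : ℕ) • Q = 0 → (2 : ℕ) • Q = 0)
    {q₁ q₂ : ℚ} {r₁ : L₁} {r₂ : M} (hr₁ : r₁ ^ 2 = algebraMap K₀ L₁ (algebraMap ℚ K₀ q₁))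
    (hgen₁ : ∀ w : L₁, ∃ a b : K₀, w = algebraMap K₀ L₁ a + algebraMap K₀ L₁ b * r₁)
    (hr₂ : r₂ ^ 2 = algebraMap K₀ M (algebraMap ℚ K₀ q₂))
    (hgen₂ : ∀ w : M, ∃ a b : L₁, w = algebraMap L₁ M a + algebraMap L₁ M b * r₂)
    (σ : K₀ ≃ₐ[ℚ] K₀) {x y : K₀} (hxy : (W.baseChange K₀).toAffine.Nonsingular x y)
    {g t : (W.baseChange K₀).toAffine.Point} (hR : Point.some x y hxy + Point.some x y hxy = g + t)
    (hg : σ • g = -g) (ht : σ • t = t) (h2t : t + t = 0)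
    (hup₁ : x ≠ algebraMap ℚ K₀ (e₁ : ℚ) → ∃ (a : ℚ) (w : M), a ≠ 0 ∧
      algebraMap K₀ M (x - algebraMap ℚ K₀ (e₁ : ℚ)) = algebraMap K₀ M (algebraMap ℚ K₀ a) * w ^ 2)
    (hup₂ : x ≠ algebraMap ℚ K₀ (e₂ : ℚ) → ∃ (a : ℚ) (w : M), a ≠ 0 ∧
      algebraMap K₀ M (x - algebraMap ℚ K₀ (e₂ : ℚ)) = algebraMap K₀ M (algebraMap ℚ K₀ a) * w ^ 2) :
    σ • Point.some x y hxy = -Point.some x y hxy := by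
  -- step (2): (MQ) brings the rational class down to `K₀`
  have hrat₁ : x ≠ algebraMap ℚ K₀ (e₁ : ℚ) →
      ∃ (a : ℚ) (u : K₀), x - algebraMap ℚ K₀ (e₁ : ℚ) = algebraMap ℚ K₀ a * u ^ 2 := by
    intro hx
    obtain ⟨a, w, ha, hw⟩ := hup₁ hx
    exact exists_ratCast_mul_sq_of_biquadratic hr₁ hgen₁ hr₂ hgen₂ ha ⟨w, hw⟩
  have hrat₂ : x ≠ algebraMap ℚ K₀ (e₂ : ℚ) →
      ∃ (a : ℚ) (u : K₀), x - algebraMap ℚ K₀ (e₂ : ℚ) = algebraMap ℚ K₀ a * u ^ 2 := by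
    intro hx
    obtain ⟨a, w, ha, hw⟩ := hup₂ hx
    exact exists_ratCast_mul_sq_of_biquadratic hr₁ hgen₁ hr₂ hgen₂ ha ⟨w, hw⟩
  -- steps (3)–(5): `…LevelZeroRigidity`
  exact smul_eq_neg_of_half_cell h p₀ M₀ h₁₂ h₁₃ h₂₃ hM hM0 hr hgen hT4 σ hR hg ht h2t
    (twoDescentComponent_smul_of_rational σ hxy hrat₁)
    (twoDescentComponent_smul_of_rational (e₁ := (e₂ : ℚ)) (e₂ := (e₁ : ℚ)) σ hxy hrat₂)

end Assembled

end Summit.BirchSwinnertonDyer.BirchSwinnertonDyer.Theorems.GenusKolyvaginAtTwo.FullVertex.LevelZero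

end
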